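import Summits.Ventures.MM22.Rank333.ProfileCertGlue
import HarnessLib

/-!
# MM22 venture — PROFILE-CERT kernel replay: sub-instances `S ≠ 0` without S-nodes — dictionary rows relative to `S`

HONEST FRAMING (cell `pub-mm22`, seat p1 g5; V4-MENU item (0′) «kernel replay of the whole-root PROFILE-CERT»).
Checker PLUMBING with soundness theorems, written from the FROZEN format specification
`HOME/pub-mm22-p2/pcert/PROFILE-CERT-v1-frozen-20260822T2120Z.md` (sha256 59fc6c87…) only. The end declaration of the
chain (`ProfileCertGlue.rankGe21F2_of_pieces`) is an IMPLICATION whose antecedents are Wang's `Cert 3 3 3 [] 20`, a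
certified orbit table (Wang's printed values and the cell's 8 LP/LPDFS lifts), a passing singleton check and the
`NoExt` statement that the (not yet landed) data files assemble to. NOTHING here proves a bound on `R_𝔽₂(⟨3,3,3⟩)`;
no summit claim.

This file: `RowSrc.okS S` (fast sandwich to `S ++ basis`, PROFILE-CERT §4 for S ≠ 0), `RowCertS`, `rowCertS_of_parts`, `rowCertS_node`.
With `noExt_of_chunk_noS` (ProfileCertMain) this is everything the `-nosym` sub-instance certificates need from the checker side; the
remaining piece is the glue predicate `VSub` on top of LIT-2's `cert_succ_of_noProfile_sub` (not in this chain yet).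
-/

set_option autoImplicit false

namespace Summit.Ventures.MM22.ProfileCert

section Sub0

open Summit.MatrixMultiplication.OmegaCensus.GF2RankLB Summit.Ventures.MM22.GF2Cert.Profile Matrix
  Literature.Computability.AlgebraicComplexity

/-- Entry check RELATIVE TO AN INSTANCE `S` (PROFILE-CERT §4 for S ≠ 0): as `RowSrc.ok`, but the fast sandwich moves the representative's
constraint space into that of `S ++ basis` (the row's subspace `U ⊇ S`). -/
def RowSrc.okS (S : List ℕ) (reps : ℕ → List ℕ × ℕ) (r : RowSrc) : Bool :=
  let rep := reps r.orbit
  let sp := spanList rep.1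
  decide (r.mask = maskOf (spanList r.basis) ^^^ 1) && decide (rep.2 = r.lb) && r.kr.all (fun x => sp.elem x)
  && (if r.t = 1 then sandTFB 3 r.kr (S ++ r.basis) r.P r.Pi r.Q r.Qi else sandFB 3 3 r.kr (S ++ r.basis) r.P r.Pi r.Q r.Qi)

/-- Row certification relative to `S`: empty, or the members are a pattern list `K` with `Cert 3 3 3 (S ++ K) b` and `N ≤ b + cap`. -/
def RowCertS (S : List ℕ) (N : ℕ) (r : Row) : Prop :=
  r.mask = 0 ∨ ∃ (K : List ℕ) (b : ℕ), (∀ f, f ∈ K ↔ r.mask.testBit f = true) ∧ Cert 3 3 3 (S ++ K) b ∧ N ≤ b + r.cap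

/-- `S_{S ++ basis} ≤ S_{S ++ K}` when `K ⊆ spanList basis`. -/
theorem subOf_append_le_of_subset_span {S basis K : List ℕ} (hK : ∀ x ∈ K, x ∈ spanList basis) :
    subOf 3 3 (S ++ basis) ≤ subOf 3 3 (S ++ K) := by
  intro u hu
  rw [subOf, mem_constrSub] at hu ⊢
  intro κ' hκ'
  obtain ⟨κ, hκ, rfl⟩ := List.mem_map.1 hκ'
  rcases List.mem_append.1 hκ with hS | hKm
  · exact hu _ (List.mem_map.2 ⟨κ, List.mem_append.2 (Or.inl hS), rfl⟩)
  · exact form_spanList_eq_zero basis (fun v hv => hu _ (List.mem_map.2 ⟨v, List.mem_append.2 (Or.inr hv), rfl⟩)) κ (hK κ hKm)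

/-- Soundness of one dictionary entry relative to `S`. -/
theorem RowSrc.cert_of_okS {S : List ℕ} {reps : ℕ → List ℕ × ℕ} (hreps : ∀ idx, Cert 3 3 3 (reps idx).1 (reps idx).2)
    {r : RowSrc} (h : r.okS S reps = true) :
    ∃ K : List ℕ, (∀ f, f ∈ K ↔ r.mask.testBit f = true) ∧ Cert 3 3 3 (S ++ K) r.lb := by
  unfold RowSrc.okS at h
  simp only [Bool.and_eq_true, decide_eq_true_eq, List.all_eq_true] at h
  obtain ⟨⟨⟨hmask, hlb⟩, hkr⟩, hsand⟩ := h
  have hkrC : Cert 3 3 3 r.kr r.lb := by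
    have hrep := hreps r.orbit
    rw [hlb] at hrep
    exact cert_of_subset_span hrep fun x hx => by
      have := hkr x hx
      rwa [List.elem_eq_mem, decide_eq_true_eq] at this
  have hbasis : Cert 3 3 3 (S ++ r.basis) r.lb := by
    split at hsand
    · exact fun n β => le_of_sandTB (sandTB_of_sandTFB hsand) hkrC n β
    · exact fun n β => le_of_sandB (sandB_of_sandFB hsand) hkrC n β
  refine ⟨(spanList r.basis).filter (· ≠ 0), fun f => ?_,
    fun n β => hbasis n (β.ofLE (subOf_append_le_of_subset_span fun x hx => (List.mem_filter.1 hx).1))⟩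
  rw [hmask, Nat.testBit_xor, List.mem_filter]
  have h1 := (mem_iff_testBit_maskOf (spanList r.basis) f).symm
  have h2 : (1 : ℕ).testBit f = decide (f = 0) := by
    cases f with
    | zero => rfl
    | succ n => rw [Nat.testBit_succ]; simp
  rw [h2]
  have h0 := zero_mem_spanList r.basis
  cases hm : (maskOf (spanList r.basis)).testBit f <;> by_cases hf0 : f = 0 <;> simp_all

/-- **Row dictionary soundness relative to `S`** (entry checks + leaf check ⇒ every stored row certified). -/
theorem rowCertS_of_parts {S : List ℕ} {N : ℕ} {reps : ℕ → List ℕ × ℕ} (hreps : ∀ idx, Cert 3 3 3 (reps idx).1 (reps idx).2)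
    {rt : RT} {dict : List RowSrc} (hall : ∀ r ∈ dict, r.okS S reps = true)
    (hleaves : (rt.allLeaves fun row => (row.mask == 0) || dict.any (fun r => r.mask == row.mask && decide (N ≤ r.lb + row.cap))) = true) :
    ∀ i, RowCertS S N (rt.get i) := by
  intro i
  rcases RT.get_of_allLeaves rt hleaves i with h0 | hp
  · left; rw [h0]
  · simp only [Bool.or_eq_true, beq_iff_eq, List.any_eq_true, Bool.and_eq_true, decide_eq_true_eq] at hp
    rcases hp with hz | ⟨r, hr, hmask, hcap⟩
    · exact Or.inl hz
    · obtain ⟨K, hK, hC⟩ := RowSrc.cert_of_okS hreps (hall r hr)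
      exact Or.inr ⟨K, r.lb, fun f => by rw [hK, hmask], hC, hcap⟩

/-- Certification of a composed store, relative version. -/
theorem rowCertS_node {S : List ℕ} {N : ℕ} {l r : RT} (hl : ∀ i, RowCertS S N (l.get i)) (hr : ∀ i, RowCertS S N (r.get i)) :
    ∀ i, RowCertS S N ((RT.node l r).get i) := by
  intro i
  simp only [RT.get]
  split
  · exact hl _
  · exact hr _

/-- Singleton (relative dim-1) witnesses for an instance `S`: form `x`, the orbit of `S + ⟨x⟩`, an echelon representative basis `kr`,
and a fast-sandwich witness to `S ++ [x]`. -/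
structure SingleS where
  x : ℕ
  orbit : ℕ
  kr : List ℕ
  t : ℕ
  P : ℕ
  Pi : ℕ
  Q : ℕ
  Qi : ℕ
deriving Repr

/-- Relative singles check at bound `b` over the form universe `FU` (listed in order). -/
def singlesOKS (S FU : List ℕ) (b : ℕ) (reps : ℕ → List ℕ × ℕ) (ws : List SingleS) : Bool :=
  decide (ws.map SingleS.x = FU)
  && ws.all (fun w =>
    let rep := reps w.orbit
    let sp := spanList rep.1
    decide (b ≤ rep.2) && w.kr.all (fun y => sp.elem y)
    && (if w.t = 1 then sandTFB 3 w.kr (S ++ [w.x]) w.P w.Pi w.Q w.Qi else sandFB 3 3 w.kr (S ++ [w.x]) w.P w.Pi w.Q w.Qi))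

/-- **Relative singles soundness**: `Cert 3 3 3 (S ++ [x]) b` for every listed form `x`. -/
theorem cert_singleS_of_ok {S FU : List ℕ} {b : ℕ} {reps : ℕ → List ℕ × ℕ} (hreps : ∀ idx, Cert 3 3 3 (reps idx).1 (reps idx).2)
    {ws : List SingleS} (h : singlesOKS S FU b reps ws = true) : ∀ x ∈ FU, Cert 3 3 3 (S ++ [x]) b := by
  unfold singlesOKS at h
  simp only [Bool.and_eq_true, decide_eq_true_eq, List.all_eq_true] at h
  obtain ⟨hcover, hall⟩ := h
  intro x hx
  rw [← hcover] at hx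
  obtain ⟨w, hw, rfl⟩ := List.mem_map.1 hx
  obtain ⟨⟨hb, hkr⟩, hsand⟩ := hall w hw
  have hkrC : Cert 3 3 3 w.kr (reps w.orbit).2 :=
    cert_of_subset_span (hreps w.orbit) fun y hy => by
      have := hkr y hy
      rwa [List.elem_eq_mem, decide_eq_true_eq] at this
  intro n β
  refine hb.trans ?_
  split at hsand
  · exact le_of_sandTB (sandTB_of_sandTFB hsand) hkrC n β
  · exact le_of_sandB (sandB_of_sandFB hsand) hkrC n β

/-! ### The set-form validity predicate of a sub-instance and its glue (shape of LIT-2's `…_of_noValidSetSub` end theorems) -/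

/-- **Validity predicate of a sub-instance** `S` with `N` products: `N` distinct forms satisfying EVERY certified relative row
`Cert 3 3 3 (S ++ L) b` (the hypothesis shape of `Wang333Planes84.cert494_20_of_noValidSetSub`; the form universe enters only through the
entry state, so that the predicate is invariant under every generator fixing `S`). -/
def VSet (S : List ℕ) (N : ℕ) (M : Finset ℕ) : Prop :=
  M.card = N ∧ M ⊆ forms ∧ ∀ (L : List ℕ) (b : ℕ), Cert 3 3 3 (S ++ L) b → b + (M.filter fun f => f ∈ L).card ≤ N

/-- `VSet` satisfies the (symmetry-free) checker hypotheses on any store whose rows are certified relative to `S`. -/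
theorem vhyp0_set {S : List ℕ} {N : ℕ} {rt : RT} (hrt : ∀ i, RowCertS S N (rt.get i)) : VHyp0 rt N (VSet S N) := by
  classical
  refine ⟨fun M hM => hM.1, fun M hM => hM.2.1, fun M hM i => ?_⟩
  rcases hrt i with hz | ⟨K, b, hK, hC, hNb⟩
  · have : M.filter (fun f => (rt.get i).mask.testBit f = true) = ∅ := by
      ext f; simp [hz, Nat.zero_testBit]
    rw [this, Finset.card_empty]; exact Nat.zero_le _
  · have h1 := hM.2.2 K b hC
    have h2 : (M.filter fun f => (rt.get i).mask.testBit f = true) = M.filter fun f => f ∈ K := by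
      ext f; simp only [Finset.mem_filter, hK]
    rw [h2]; omega

/-- The entry state of a sub-instance without FORCE/EXCL: everything outside the form universe is OUT. -/
def initSt (outMask nOut : ℕ) : St := ⟨[], outMask, 0, nOut⟩

/-- **Set-form end shape for a sub-instance**: if the entry state's OUT mask avoids the form universe `FU` (a list of forms) and the
replay gives `NoExt`, then no `N`-set of `FU` forms is valid — exactly the `hno` of `cert494_20_of_noValidSetSub`-type theorems. -/
theorem noValidSet_of_noExt {S : List ℕ} {N : ℕ} {FU : List ℕ} {outMask nOut : ℕ} (hFU : ∀ f ∈ FU, f ∈ forms)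
    (hout : ∀ f ∈ FU, outMask.testBit f = false) (hno : NoExt (VSet S N) (initSt outMask nOut)) :
    ∀ M : Finset ℕ, M.card = N → (∀ f ∈ M, f ∈ FU) →
      (∀ (L : List ℕ) (b : ℕ), Cert 3 3 3 (S ++ L) b → b + (M.filter fun f => f ∈ L).card ≤ N) → False :=
  fun M hc hF hrows => hno M ⟨hc, fun f hf => hFU f (hF f hf), hrows⟩ ⟨fun _ hf => by simp [initSt] at hf, fun f hf => hout f (hF f hf)⟩

/-- The OUT mask of an entry state avoids `FU` — Boolean form for `decide`. -/
def outAvoidsB (outMask : ℕ) (FU : List ℕ) : Bool := FU.all fun f => !(outMask.testBit f)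

/-- Unpacking `outAvoidsB`. -/
theorem out_avoids_of_B {outMask : ℕ} {FU : List ℕ} (h : outAvoidsB outMask FU = true) : ∀ f ∈ FU, outMask.testBit f = false := by
  unfold outAvoidsB at h
  rw [List.all_eq_true] at h
  intro f hf
  simpa using h f hf

/-- All forms of `FU` are forms — Boolean form for `decide`. -/
def allFormsB (FU : List ℕ) : Bool := FU.all isForm

/-- Unpacking `allFormsB`. -/
theorem forms_of_allFormsB {FU : List ℕ} (h : allFormsB FU = true) : ∀ f ∈ FU, f ∈ forms := by
  unfold allFormsB at h
  rw [List.all_eq_true] at h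
  exact fun f hf => isForm_iff.1 (h f hf)


end Sub0

end Summit.Ventures.MM22.ProfileCert
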